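/-
Copyright (c) 2026 the pub-hodgecm-mathlib formalisation cell (harness21).  Prover seat hodgecm-mathlib-R90-C10-p08 (g0), HCML SLAB R90-TF, section S1
«Ch10-local» (planner `R90-C10-plan`, EMIT S1 WAVE 1 2026-09-04T15:32:01Z), socket S1#2 `R90.S1.stub_R90_122_bz_twoConstituents` (second hand, road β′
«UNITARY COMPLETE REDUCIBILITY + FROBENIUS MULTIPLICITY ONE»), file C of three.  2026-09-04.
-/
import Literature.NumberTheory.Automorphic.InducedCharacterInvariantForm                  -- ★ `exists_isCompl_subrepresentation_smoothIndRep_of_norm_sq_eq` (the form `∫_K f̄₁ f₂` on `Ind_H^G(χ δ_H^{1/2})`)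
import Literature.NumberTheory.Automorphic.UnitaryGroupCMLocalIwasawa                      -- ★ Iwasawa `exists_borel_mul_mem_cmLocalIntegralLevel` (`G = B · K_v`, every `v`)
import Literature.NumberTheory.Automorphic.LocalUnitaryGroupUnimodularIsotropic            -- ★ `isMulRightInvariant_cmDatum_local_antidiagOne` (`U(Φ_N)(L⁺_v)` unimodular)
import Literature.NumberTheory.Automorphic.LocalUnitaryGroupCongrMeasure                   -- ★ instances `secondCountableTopology_local`, `locallyCompactSpace_local`
import Summits.HodgeConjecture.HodgeConjecture.Theorems.F0P3XiUnramNonsplitInstance          -- ★ `isAdmissible_cmPrincipalSeries`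
import HarnessLib

/-!
# R90 · S1 — a UNITARY character `χ` of the torus: every subrepresentation of the principal series `i_G(χ)` of `U(Φ₃)(L⁺_v)` has a `G`-stable complement

Cell `pub/hodgecm-mathlib`, crux H413 = `stmt-HodgeConjecture-24833`; `--supports stmt-HodgeConjecture-24833 --as helper`; THEOREMS ONLY (no definition ∕
instance ∕ notation ∕ named fact ∕ `sorry`); never imports `Cruxes/…/Lines`.  COUNT-NEUTRAL.  File C of the three-file payment of socket S1#2
`Summit.HodgeConjecture.HodgeConjecture.R90.S1.stub_R90_122_bz_twoConstituents` ([Rogawski1990, §12.2 p. 173] «if `i_G(χ)` is reducible, it contains exactly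
two irreducible constituents ([BZ])»; self-dual case `wχ = χ`, where `χ` is unitary by file U ★ `R90S1WeylFixedTorusCharUnitary`).

THE MATHEMATICS ([BernsteinZelevinsky1976, 2.25 (c)]; [BernsteinZelevinsky1977, Prop. 1.9 (c)]; [Casselman1995, Prop. 2.1.5, §3.1]; [Rogawski1990, §12.2 p. 173]).
`i_G(χ) = Ind_B^G(χ δ_B^{1/2})` (★ `cmPrincipalSeries L 3 v χ = normalizedInd (cmBorelTriple L 3 v) (𝟙 ⊗ χ) = smoothIndRep B (χ ∘ proj ⊗ δ_B^{1/2})`,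
definitionally).  For `‖χ‖ = 1` the inducing datum `σ(p) = δ_B^{1/2}(p) χ(proj p)` has `‖σ(p)‖² = Δ_B(p)`, so `⟨f₁, f₂⟩ = ∫_{K_v} f̄₁ f₂` is a `G`-invariant
positive definite Hermitian form on `i_G(χ)` (★ `InducedCharacterInvariantForm`: `B` closed ★ `isClosed_borelU`, `K_v = U(Φ₃)(𝒪_v)` compact open ★
`isCompact_isOpen_cmLocalIntegralLevel`, Iwasawa `G = B K_v` ★ `exists_borel_mul_mem_cmLocalIntegralLevel`, `G` unimodular ★ `isMulRightInvariant_cmDatum_local_antidiagOne`),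
and since `i_G(χ)` is admissible (★ `isAdmissible_cmPrincipalSeries`) every `G`-stable `N ≤ i_G(χ)` has the `G`-stable complement `N^⊥`
(★ `UnitaryAdmissibleCompleteReducibility.exists_isCompl_subrepresentation_of_invariant_form`).
* **`exists_isCompl_subrepresentation_cmPrincipalSeries_of_norm_eq_one`** — `∀ t, ‖χ t‖ = 1` ⇒ `∀ N, ∃ N', IsCompl N N'` in `i_G(χ)` (every finite `v`).
HONEST LABEL: HC_CM is proved only modulo the 7 printed citations (2 remaining named inputs: hLiu418 = stmt-HodgeConjecture-24832, h413 = stmt-HodgeConjecture-24833)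
until rung 0 closes; count-neutral helper.

## Tree search
★ `exists_isCompl_subrepresentation_smoothIndRep_of_norm_sq_eq`, `isClosed_borelU`, `isCompact_isOpen_cmLocalIntegralLevel`, `exists_borel_mul_mem_cmLocalIntegralLevel`,
`isMulRightInvariant_cmDatum_local_antidiagOne`, `isAdmissible_cmPrincipalSeries`, `rootDeltaChar_apply`, `Representation.twist_apply`; Mathlib `MeasureTheory.Measure.haar`,
`Complex.norm_real`, `Real.sq_sqrt`.  Dedup: `rg "exists_isCompl_subrepresentation_cmPrincipalSeries"` — no hits.

## References
* [BernsteinZelevinsky1976] I. N. Bernstein, A. V. Zelevinsky, *Representations of the group GL(n, F) where F is a non-archimedean local field*, Russian Math.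
  Surveys 31:3 (1976), 2.25 (c), §4.1.
* [BernsteinZelevinsky1977] I. N. Bernstein, A. V. Zelevinsky, *Induced representations of reductive p-adic groups I*, Ann. Sci. ÉNS 10 (1977), Prop. 1.9 (c), §2.3.
* [Casselman1995] W. Casselman, *Introduction to the theory of admissible representations of p-adic reductive groups* (1995), Prop. 2.1.5, §3.1.
* [Rogawski1990] J. D. Rogawski, *Automorphic Representations of Unitary Groups in Three Variables*, Ann. of Math. Stud. 123 (1990), §12.2 p. 173.
-/

set_option autoImplicit false
set_option linter.dupNamespace false

noncomputable section

open NumberField IsDedekindDomain MeasureTheory Measure Topology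
open scoped Matrix MatrixGroups NNReal ComplexConjugate

namespace Summit.HodgeConjecture.HodgeConjecture.R90.S1

open Literature.NumberTheory Literature.NumberTheory.Automorphic Literature.NumberTheory.Automorphic.UnitaryGroup
open Summit.HodgeConjecture.HodgeConjecture.Cruxes.H413

variable (L : Type) [Field L] [NumberField L] [IsCMField L] (v : HeightOneSpectrum (𝓞 ↥(maximalRealSubfield L)))

set_option synthInstance.maxHeartbeats 400000 in
set_option maxHeartbeats 4000000 in  -- the `rfl`-bridge `cmPrincipalSeries L 3 v χ = smoothIndRep B (χ ∘ proj ⊗ δ_B^{1/2})` at the CM carrier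
/-- **UNITARY PRINCIPAL SERIES OF `U(Φ₃)(L⁺_v)` ARE COMPLETELY REDUCIBLE** (every finite `v`): if `‖χ(t)‖ = 1` for all `t ∈ T(L⁺_v)`, then every
`G`-stable subspace `N` of `i_G(χ)` (★ `cmPrincipalSeries L 3 v χ`) has a `G`-stable complement — the orthogonal of `N` for the invariant form
`⟨f₁, f₂⟩ = ∫_{K_v} f̄₁ f₂` on `Ind_B^G(χ δ_B^{1/2})` (★ `exists_isCompl_subrepresentation_smoothIndRep_of_norm_sq_eq` at `H = B`, `K = K_v = U(Φ₃)(𝒪_v)`,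
`‖δ_B^{1/2}(p) χ(proj p)‖² = Δ_B(p)`; `G = B K_v` ★ Iwasawa, `G` unimodular ★, `i_G(χ)` admissible ★).
[cite: BernsteinZelevinsky1976, 2.25 (c)] [cite: BernsteinZelevinsky1977, Prop. 1.9 (c)] [cite: Casselman1995, Prop. 2.1.5, §3.1] [cite: Rogawski1990, §12.2 p. 173] -/
theorem exists_isCompl_subrepresentation_cmPrincipalSeries_of_norm_eq_one
    (χ : ↥(torusU (conjLocal L (IsCMField.complexConj L) v) (cmLocalForm L 3 v)) →* ℂˣ) (hχ : ∀ t, ‖((χ t : ℂˣ) : ℂ)‖ = 1)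
    (N : Subrepresentation (cmPrincipalSeries L 3 v χ)) :
    ∃ N' : Subrepresentation (cmPrincipalSeries L 3 v χ), IsCompl N.toSubmodule N'.toSubmodule := by
  haveI := locallyCompactSpace_cmBorelU L 3 v
  -- the carrier `G = U(Φ₃)(L⁺_v) = (cmDatum L 3 Φ₃).Local v` (`rfl`): locally compact, second countable, Hausdorff; Borel σ-algebra
  haveI : LocallyCompactSpace ↥(unitaryGroupOfForm (conjLocal L (IsCMField.complexConj L) v) (cmLocalForm L 3 v)) :=
    locallyCompactSpace_local (IsCMField.complexConj L) 3 _ v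
  haveI : SecondCountableTopology ↥(unitaryGroupOfForm (conjLocal L (IsCMField.complexConj L) v) (cmLocalForm L 3 v)) :=
    secondCountableTopology_local (E := L) (c := IsCMField.complexConj L) (N := 3) (v := v)
      (J := Matrix.of fun i j : Fin 3 => if i.val + j.val + 1 = 3 then (1 : L) else 0)
  letI mG : MeasurableSpace ↥(unitaryGroupOfForm (conjLocal L (IsCMField.complexConj L) v) (cmLocalForm L 3 v)) := borel _
  haveI bG : BorelSpace ↥(unitaryGroupOfForm (conjLocal L (IsCMField.complexConj L) v) (cmLocalForm L 3 v)) := ⟨rfl⟩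
  -- a Haar measure, right invariant since `U(Φ₃)(L⁺_v)` is unimodular
  let μG : Measure ↥(unitaryGroupOfForm (conjLocal L (IsCMField.complexConj L) v) (cmLocalForm L 3 v)) := Measure.haar
  have hμ : μG.IsHaarMeasure := inferInstance
  haveI : μG.IsMulRightInvariant := @isMulRightInvariant_cmDatum_local_antidiagOne L _ _ _ 3 v mG bG μG hμ
  -- `K_v = U(Φ₃)(𝒪_v)` compact open, `B` closed, `G = B K_v`
  let K : Subgroup ↥(unitaryGroupOfForm (conjLocal L (IsCMField.complexConj L) v) (cmLocalForm L 3 v)) :=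
    cmLocalIntegralLevel L 3 (Matrix.of fun i j : Fin 3 => if i.val + j.val + 1 = 3 then (1 : L) else 0) v
  have hK : IsCompact (K : Set ↥(unitaryGroupOfForm (conjLocal L (IsCMField.complexConj L) v) (cmLocalForm L 3 v))) ∧
      IsOpen (K : Set ↥(unitaryGroupOfForm (conjLocal L (IsCMField.complexConj L) v) (cmLocalForm L 3 v))) :=
    isCompact_isOpen_cmLocalIntegralLevel L 3 (Matrix.of fun i j : Fin 3 => if i.val + j.val + 1 = 3 then (1 : L) else 0) v
  have hB : IsClosed ((cmBorelTriple L 3 v).P : Set ↥(unitaryGroupOfForm (conjLocal L (IsCMField.complexConj L) v) (cmLocalForm L 3 v))) :=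
    isClosed_borelU _ _
  have hBK : ∀ g : ↥(unitaryGroupOfForm (conjLocal L (IsCMField.complexConj L) v) (cmLocalForm L 3 v)),
      ∃ p ∈ (cmBorelTriple L 3 v).P, ∃ k ∈ K, g = p * k := fun g => by
    obtain ⟨h, κ, hκ, hg⟩ := exists_borel_mul_mem_cmLocalIntegralLevel L 3 v g
    exact ⟨h, h.2, κ, hκ, hg⟩
  -- the inducing datum `σ(p) = δ_B^{1/2}(p) χ(proj p)` has `‖σ(p)‖² = Δ_B(p)`
  have hσ : ∀ p : ↥(cmBorelTriple L 3 v).P,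
      ‖Representation.twist (((Representation.trivial ℂ ↥(cmBorelTriple L 3 v).M ℂ).twist χ).comp (cmBorelTriple L 3 v).proj)
          (rootDeltaChar (cmBorelTriple L 3 v).P) p 1‖ ^ 2 = ((modularCharacter p : ℝ≥0) : ℝ) := by
    intro p
    simp only [Representation.twist_apply, MonoidHom.coe_comp, Function.comp_apply, Representation.trivial, MonoidHom.one_apply,
      Module.End.one_apply, smul_eq_mul, mul_one, norm_mul, hχ]
    rw [rootDeltaChar_apply, Complex.norm_real, Real.norm_eq_abs, Real.coe_sqrt, sq_abs, Real.sq_sqrt (NNReal.coe_nonneg _)]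
  have hadm : (Representation.smoothIndRep (cmBorelTriple L 3 v).P
      (Representation.twist (((Representation.trivial ℂ ↥(cmBorelTriple L 3 v).M ℂ).twist χ).comp (cmBorelTriple L 3 v).proj)
        (rootDeltaChar (cmBorelTriple L 3 v).P))).IsAdmissible :=
    F0P3XiUnramNonsplitInstance.isAdmissible_cmPrincipalSeries L v χ
  -- the generic statement on `Ind_B^G(χ δ_B^{1/2})`, then ONE definitional transport to `cmPrincipalSeries L 3 v χ`
  have key := exists_isCompl_subrepresentation_smoothIndRep_of_norm_sq_eq _ hB hK.2 hK.1 hBK μG hσ hadm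
  exact key N

end Summit.HodgeConjecture.HodgeConjecture.R90.S1

end
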